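import Summits.BirchSwinnertonDyer.BirchSwinnertonDyer.Theorems.LambdaTransportDoorAtTwoNuTwoCriterion
import Summits.BirchSwinnertonDyer.BirchSwinnertonDyer.Theorems.ByReductionTypeAtTwoOrdEisensteinHalfShaAlgebra
import HarnessLib

/-!
# Constant terms in `Λ`: `μ`, `λ`, and the `ν₂`-divisibility bit (bsd-rank2 [rank2-p2] GEN 67, part D1 — pure algebra)

Cell `bsd-rank2`, seat p2, GEN 67.  PURE `Λ`-ALGEBRA, no elliptic curve: the constant term `g(0)` of `g ∈ Λ = ℤ_p⟦T⟧` read against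
`μ(g)` and `λ(g)`, and — at `p = 2` — the exact extra bit that excludes `ν₂ = T² + 2T + 2 = Φ₄(1+T)` as a divisor of an
element of `λ`-invariant `2`.  Consumed by part D2 (`LambdaTransportDoorAtTwoMatsunoClassCentralValuation`), where `g` is an
integral lift of `L₂(A,T)` on the Matsuno class `𝒞(15A8)` and `ν₂ ∣ g ⟺ L(A, χ₁₆, 1) = 0`.

* §1 (any `p`; `g(0) = p^{μ(g)}·(pfree g)(0)` is `EisensteinShaCurrency.constantCoeff_eq_pow_mu_mul`): `λ(g) ≥ 1 ⟹ p ∣ (pfree g)(0) ⟹ p^{μ(g)+1} ∣ g(0)`;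
  `λ(g) = 0 ⟹ (pfree g)(0) ∈ ℤ_pˣ`; `p^{μ(g)+k} ∣ g(0) ⟺ p^k ∣ (pfree g)(0)`.
* §2 (`p = 2`): **`ν₂ ∣ L`, `λ(L) = 2 ⟹ L(0) = 2^{μ(L)+1}·unit`**; hence **`2^{μ(L)+2} ∣ L(0) ⟹ ν₂ ∤ L`** (the one-bit input);
  `μ(T+2) = 0`; `(T+2) ∣ L ⟹ 2^{μ(L)+2} ∣ L(0)`; `T ∣ L ⟹ L(0) = 0`.
-/

-- planner-bsd-rank2-p2-g67-0 (cell bsd-rank2, seat p2, GEN 67, part D1)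

set_option linter.dupNamespace false
set_option autoImplicit false

noncomputable section

open scoped Classical MatrixGroups ModularForm

open CongruenceSubgroup WeierstrassCurve Literature.NumberTheory.EllipticCurves
  Literature.NumberTheory.EllipticCurves.ModularForms Literature.NumberTheory.EllipticCurves.IwasawaAlgebra
  Literature.NumberTheory.EllipticCurves.Rank1Residual Literature.NumberTheory.EllipticCurves.Rank1Residual.Typed
  Literature.NumberTheory.EllipticCurves.Greenberg1999
  Summit.BirchSwinnertonDyer.Rank1Residual.X1.MuLambda Summit.BirchSwinnertonDyer.Rank1Residual.X1.MuPart
  Summit.BirchSwinnertonDyer.Rank1Residual.X1.ParitySqueeze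
  Summit.BirchSwinnertonDyer.Rank2 Summit.BirchSwinnertonDyer.Rank2.LambdaTransportDoor
  Summit.BirchSwinnertonDyer.BirchSwinnertonDyer.Theorems.LambdaTransportDoorAtTwoLayerOne
  Summit.BirchSwinnertonDyer.BirchSwinnertonDyer.Theorems.LambdaTransportDoorAtTwoLayerTwoAlgebra
  Summit.BirchSwinnertonDyer.BirchSwinnertonDyer.Theorems.LambdaTransportDoorAtTwoMatsunoClassSecondFixedPoint
  Summit.BirchSwinnertonDyer.BirchSwinnertonDyer.Theorems.LambdaTransportDoorAtTwoNuTwoCriterion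
  Summit.BirchSwinnertonDyer.BirchSwinnertonDyer.Theorems.EisensteinShaCurrency

universe u

namespace Summit.BirchSwinnertonDyer.BirchSwinnertonDyer.Theorems.LambdaTransportDoorAtTwoNuTwoConstantTerm

/-! ## §1 Any prime: the constant term against `μ` and `λ` -/

section AnyPrime

variable {p : ℕ} [Fact p.Prime]

-- `g(0) = p^{μ(g)}·(pfree g)(0)` is the landed `EisensteinShaCurrency.constantCoeff_eq_pow_mu_mul` (reused, not restated).

/-- **`λ ≥ 1` forces `p ∣ (pfree g)(0)`**: the reduction of `pfree g` mod `p` has order `λ(g) ≥ 1`, so its constant term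
vanishes in `𝔽_p` (Weierstrass: the distinguished polynomial has constant term in `pℤ_p`). [cite: Washington1997, §7.1] -/
theorem p_dvd_constantCoeff_pfree_of_lam_pos {g : IwasawaAlgebra p} (hlam : 0 < lam g) :
    (p : ℤ_[p]) ∣ PowerSeries.constantCoeff (pfree g) := by
  have hpos : ((0 : ℕ) : ℕ∞) < (red (pfree g)).order := by
    rw [Nat.cast_zero, pos_iff_ne_zero]
    intro h0
    have : lam g = 0 := by
      change (red (pfree g)).order.toNat = 0
      rw [h0]; rfl
    omega
  have h0 := PowerSeries.coeff_of_lt_order 0 hpos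
  rwa [PowerSeries.coeff_map, PowerSeries.coeff_zero_eq_constantCoeff_apply, IsLocalRing.residue_eq_zero_iff,
    PadicInt.maximalIdeal_eq_span_p, Ideal.mem_span_singleton] at h0

/-- **`λ ≥ 1 ⟹ p^{μ(g)+1} ∣ g(0)`.** [cite: Washington1997, §7.1] -/
theorem pow_mu_succ_dvd_constantCoeff_of_lam_pos {g : IwasawaAlgebra p} (hlam : 0 < lam g) :
    (p : ℤ_[p]) ^ (mu g + 1) ∣ PowerSeries.constantCoeff g := by
  obtain ⟨t, ht⟩ := p_dvd_constantCoeff_pfree_of_lam_pos hlam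
  exact ⟨t, by rw [constantCoeff_eq_pow_mu_mul, ht, pow_succ, mul_assoc]⟩

/-- **`λ = 0 ⟹ (pfree g)(0) ∈ ℤ_pˣ`** (for `g ≠ 0`: the reduction of `pfree g` has order `0`, i.e. nonzero constant term
in `𝔽_p`). [cite: Washington1997, §7.1] -/
theorem isUnit_constantCoeff_pfree_of_lam_eq_zero {g : IwasawaAlgebra p} (hg : g ≠ 0) (hlam : lam g = 0) :
    IsUnit (PowerSeries.constantCoeff (pfree g)) := by
  have h := PowerSeries.coeff_order (red_pfree_ne_zero hg)
  change PowerSeries.coeff (lam g) (red (pfree g)) ≠ 0 at h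
  rw [hlam, PowerSeries.coeff_map, PowerSeries.coeff_zero_eq_constantCoeff_apply] at h
  by_contra hnu
  exact h ((IsLocalRing.residue_eq_zero_iff _).mpr ((IsLocalRing.mem_maximalIdeal _).mpr (mem_nonunits_iff.mpr hnu)))

/-- **`λ = 0 ⟹ g(0) = p^{μ(g)} · u`, `u ∈ ℤ_pˣ`** (`g ≠ 0`). [cite: Washington1997, §7.1] -/
theorem constantCoeff_eq_pow_mu_mul_unit_of_lam_eq_zero {g : IwasawaAlgebra p} (hg : g ≠ 0) (hlam : lam g = 0) :
    ∃ u : ℤ_[p], IsUnit u ∧ PowerSeries.constantCoeff g = (p : ℤ_[p]) ^ mu g * u :=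
  ⟨_, isUnit_constantCoeff_pfree_of_lam_eq_zero hg hlam, constantCoeff_eq_pow_mu_mul g⟩

/-- `p^{μ(g)+k} ∣ g(0) ⟺ p^k ∣ (pfree g)(0)`: divisibility of the constant term beyond `p^{μ}` is a property of the `p`-free
part alone (equivalently of the distinguished polynomial of `g`). [folklore] -/
theorem pow_mu_add_dvd_constantCoeff_iff (g : IwasawaAlgebra p) (k : ℕ) :
    (p : ℤ_[p]) ^ (mu g + k) ∣ PowerSeries.constantCoeff g ↔ (p : ℤ_[p]) ^ k ∣ PowerSeries.constantCoeff (pfree g) := by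
  have hp0 : (p : ℤ_[p]) ^ mu g ≠ 0 := pow_ne_zero _ (by exact_mod_cast (Fact.out : p.Prime).ne_zero)
  rw [constantCoeff_eq_pow_mu_mul, pow_add]
  exact mul_dvd_mul_iff_left hp0

end AnyPrime

/-! ## §2 `p = 2`: the `ν₂`-bit -/

local notation "ν₂" => (PowerSeries.X * PowerSeries.X + PowerSeries.C (2 : ℤ_[2]) * PowerSeries.X + PowerSeries.C (2 : ℤ_[2]) :
  IwasawaAlgebra 2)

/-- `ν₂(0) = 2`. -/
theorem constantCoeff_nu_two : PowerSeries.constantCoeff ν₂ = 2 := by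
  simp only [map_add, map_mul, PowerSeries.constantCoeff_X, PowerSeries.constantCoeff_C, mul_zero, zero_add]

/-- `2 ∈ 𝔪_{ℤ₂}`. -/
theorem two_mem_maximalIdeal : (2 : ℤ_[2]) ∈ IsLocalRing.maximalIdeal ℤ_[2] := by
  rw [PadicInt.maximalIdeal_eq_span_p, Ideal.mem_span_singleton, Nat.cast_ofNat]

/-- An element of `ℤ₂` divisible by `2` is not a unit. -/
theorem not_isUnit_of_two_dvd {u : ℤ_[2]} (h : (2 : ℤ_[2]) ∣ u) : ¬ IsUnit u := fun hu ↦
  (IsLocalRing.mem_maximalIdeal _).mp two_mem_maximalIdeal (isUnit_of_dvd_unit h hu)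

/-- The a-priori law at `p = 2`: `λ(L) = 2 ⟹ 2^{μ(L)+1} ∣ L(0)`. [cite: Washington1997, §7.1] -/
theorem pow_mu_succ_dvd_constantCoeff {L : IwasawaAlgebra 2} (hlam : lam L = 2) :
    (2 : ℤ_[2]) ^ (mu L + 1) ∣ PowerSeries.constantCoeff L := by
  have h := pow_mu_succ_dvd_constantCoeff_of_lam_pos (p := 2) (g := L) (by rw [hlam]; norm_num)
  rwa [Nat.cast_ofNat] at h

/-- ★ **`ν₂ ∣ L` with `λ(L) = 2` pins the constant term: `L(0) = 2^{μ(L)+1} · u`, `u ∈ ℤ₂ˣ`** — `L = ν₂·g` with `λ(g) = 0`,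
`g(0) = 2^{μ(g)}·unit`, `ν₂(0) = 2`, and `μ(g) = μ(L)` (squeezed between `μ(g) ≤ μ(ν₂ g)` and `2^{μ(L)+1} ∣ L(0)`).
[cite: Washington1997, §7.1, §7.2] -/
theorem constantCoeff_eq_of_nu_two_dvd {L : IwasawaAlgebra 2} (hL : L ≠ 0) (hlam : lam L = 2) (hν : ν₂ ∣ L) :
    ∃ u : ℤ_[2], IsUnit u ∧ PowerSeries.constantCoeff L = 2 ^ (mu L + 1) * u := by
  obtain ⟨g, rfl⟩ := hν
  have hν0 : ν₂ ≠ 0 := prime_nu_two.ne_zero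
  have hg0 : g ≠ 0 := fun h ↦ hL (by rw [h, mul_zero])
  have hlamg : lam g = 0 := by
    have h := lam_mul hν0 hg0
    rw [hlam, lam_nu_two] at h
    omega
  obtain ⟨u, hu, hgu⟩ := constantCoeff_eq_pow_mu_mul_unit_of_lam_eq_zero hg0 hlamg
  rw [Nat.cast_ofNat] at hgu
  have hμle : mu g ≤ mu (ν₂ * g) := by
    rw [mu_mul hν0 hg0]; exact Nat.le_add_left _ _
  have hc : PowerSeries.constantCoeff (ν₂ * g) = 2 ^ (mu g + 1) * u := by
    rw [map_mul, constantCoeff_nu_two, hgu, pow_succ]; ring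
  -- `2^{μ(ν₂ g)+1} ∣ (ν₂ g)(0) = 2^{μ g + 1} u` forces `μ(ν₂ g) ≤ μ g`
  have hdvd := pow_mu_succ_dvd_constantCoeff hlam
  rw [hc] at hdvd
  have hμge : mu (ν₂ * g) ≤ mu g := by
    by_contra hlt
    rw [not_le] at hlt
    obtain ⟨t, ht⟩ := hdvd
    have h2u : (2 : ℤ_[2]) ∣ u := by
      refine ⟨2 ^ (mu (ν₂ * g) - mu g - 1) * t, mul_left_cancel₀ (pow_ne_zero (mu g + 1) (two_ne_zero (α := ℤ_[2]))) ?_⟩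
      rw [ht, ← mul_assoc, ← mul_assoc, ← pow_succ, ← pow_add]
      congr 2; omega
    exact not_isUnit_of_two_dvd h2u hu
  exact ⟨u, hu, by rw [hc, le_antisymm hμge hμle]⟩

/-- ★★ **THE ONE-BIT INPUT, `Λ`-form: `2^{μ(L)+2} ∣ L(0) ⟹ ν₂ ∤ L`** (for `L ≠ 0`, `λ(L) = 2`).  One bit beyond the a-priori
`2^{μ(L)+1} ∣ L(0)`; it covers `L(0) = 0`.  Equivalently `4 ∣ (pfree L)(0)` (`pow_mu_add_dvd_constantCoeff_iff`), i.e.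
`4 ∣ P(0)` for the distinguished polynomial `P = T² + aT + b` of `L` (`ν₂ ∣ L ⟺ P = ν₂ ⟹ b = 2`).
[cite: Washington1997, §7.1, §7.2] -/
theorem not_nu_two_dvd_of_pow_mu_add_two_dvd {L : IwasawaAlgebra 2} (hL : L ≠ 0) (hlam : lam L = 2)
    (h4 : (2 : ℤ_[2]) ^ (mu L + 2) ∣ PowerSeries.constantCoeff L) : ¬ ν₂ ∣ L := by
  intro hν
  obtain ⟨u, hu, hc⟩ := constantCoeff_eq_of_nu_two_dvd hL hlam hν
  rw [hc] at h4
  obtain ⟨t, ht⟩ := h4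
  have h2u : (2 : ℤ_[2]) ∣ u :=
    ⟨t, mul_left_cancel₀ (pow_ne_zero (mu L + 1) (two_ne_zero (α := ℤ_[2]))) (by rw [ht, ← mul_assoc, ← pow_succ])⟩
  exact not_isUnit_of_two_dvd h2u hu

/-- The same with the input on the `2`-free part: **`4 ∣ (pfree L)(0) ⟹ ν₂ ∤ L`** (`L ≠ 0`, `λ(L) = 2`). [cite: Washington1997, §7.2] -/
theorem not_nu_two_dvd_of_four_dvd_constantCoeff_pfree {L : IwasawaAlgebra 2} (hL : L ≠ 0) (hlam : lam L = 2)
    (h4 : (4 : ℤ_[2]) ∣ PowerSeries.constantCoeff (pfree L)) : ¬ ν₂ ∣ L := by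
  refine not_nu_two_dvd_of_pow_mu_add_two_dvd hL hlam ?_
  have h := (pow_mu_add_dvd_constantCoeff_iff (p := 2) L 2).mpr (by rw [Nat.cast_ofNat]; norm_num; exact h4)
  rwa [Nat.cast_ofNat] at h

/-- `μ(T + 2) = 0` (its reduction mod `2` is `T ≠ 0`). [cite: Washington1997, §7.1] -/
theorem mu_X_add_C_two : mu (PowerSeries.X + PowerSeries.C (2 : ℤ_[2]) : IwasawaAlgebra 2) = 0 := by
  have hred : red (PowerSeries.X + PowerSeries.C (2 : ℤ_[2]) : IwasawaAlgebra 2) ≠ 0 := by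
    intro h
    have h1 := congrArg (PowerSeries.coeff 1) h
    rw [PowerSeries.coeff_map, map_add, PowerSeries.coeff_one_X, PowerSeries.coeff_C, if_neg one_ne_zero, add_zero,
      map_one, map_zero] at h1
    exact one_ne_zero h1
  exact (mu_eq_and_pfree_eq hred (a := 0) (by rw [pow_zero, map_one, one_mul])).1

/-- `λ(T + 2) = 1` and `T + 2 ≠ 0`. [cite: Washington1997, §7.1] -/
theorem lam_X_add_C_two : (PowerSeries.X + PowerSeries.C (2 : ℤ_[2]) : IwasawaAlgebra 2) ≠ 0 ∧
    lam (PowerSeries.X + PowerSeries.C (2 : ℤ_[2]) : IwasawaAlgebra 2) = 1 := by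
  refine ⟨fun h ↦ ?_, ?_⟩
  · have h' := congrArg PowerSeries.constantCoeff h
    rw [map_add, PowerSeries.constantCoeff_X, PowerSeries.constantCoeff_C, zero_add, map_zero] at h'
    norm_num at h'
  · have hd : (Polynomial.X + Polynomial.C 2 : Polynomial ℤ_[2]).IsDistinguishedAt (IsLocalRing.maximalIdeal ℤ_[2]) := by
      refine ⟨⟨fun {i} hi ↦ ?_⟩, Polynomial.monic_X_add_C 2⟩
      rw [Polynomial.natDegree_X_add_C] at hi
      obtain rfl : i = 0 := by omega
      rw [Polynomial.coeff_add, Polynomial.coeff_X_zero, Polynomial.coeff_C_zero, zero_add]; exact two_mem_maximalIdeal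
    rw [← Polynomial.coe_C, ← Polynomial.coe_X, ← Polynomial.coe_add, lam_coe_eq_natDegree hd, Polynomial.natDegree_X_add_C]

/-- **The input holds on the `(T+2)`-door: `(T + 2) ∣ L`, `λ(L) = 2 ⟹ 2^{μ(L)+2} ∣ L(0)`** (`L = (T+2)·g`, `λ(g) = 1`,
`2^{μ(g)+1} ∣ g(0)`, `μ(g) = μ(L)`). [cite: Washington1997, §7.1] -/
theorem pow_mu_add_two_dvd_of_X_add_C_two_dvd {L : IwasawaAlgebra 2} (hL : L ≠ 0) (hlam : lam L = 2)
    (h : (PowerSeries.X + PowerSeries.C (2 : ℤ_[2]) : IwasawaAlgebra 2) ∣ L) :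
    (2 : ℤ_[2]) ^ (mu L + 2) ∣ PowerSeries.constantCoeff L := by
  obtain ⟨g, rfl⟩ := h
  obtain ⟨hq0, hlamq⟩ := lam_X_add_C_two
  have hg0 : g ≠ 0 := fun h ↦ hL (by rw [h, mul_zero])
  have hlamg : lam g = 1 := by
    have h := lam_mul hq0 hg0
    rw [hlam, hlamq] at h
    omega
  have hμ : mu ((PowerSeries.X + PowerSeries.C (2 : ℤ_[2]) : IwasawaAlgebra 2) * g) = mu g := by
    rw [mu_mul hq0 hg0, mu_X_add_C_two, zero_add]
  have hdvd := pow_mu_succ_dvd_constantCoeff_of_lam_pos (p := 2) (g := g) (by rw [hlamg]; norm_num)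
  rw [Nat.cast_ofNat] at hdvd
  obtain ⟨t, ht⟩ := hdvd
  refine ⟨t, ?_⟩
  rw [map_mul, map_add, PowerSeries.constantCoeff_X, PowerSeries.constantCoeff_C, zero_add, ht, hμ, pow_succ]; ring

/-- The input holds trivially on the `T`-door: `T ∣ L ⟹ L(0) = 0`. -/
theorem constantCoeff_eq_zero_of_X_dvd {L : IwasawaAlgebra 2} (h : (PowerSeries.X : IwasawaAlgebra 2) ∣ L) :
    PowerSeries.constantCoeff L = 0 := by
  obtain ⟨g, rfl⟩ := h
  rw [map_mul, PowerSeries.constantCoeff_X, zero_mul]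

end Summit.BirchSwinnertonDyer.BirchSwinnertonDyer.Theorems.LambdaTransportDoorAtTwoNuTwoConstantTerm

end
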